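import Literature.MathematicalPhysics.QuantumLattice.HubbardLangerMattisFermiSum
import Literature.MathematicalPhysics.QuantumLattice.HubbardRingPerronFrobeniusProofs
import Literature.MathematicalPhysics.QuantumLattice.SectorVariationalBounds
import Literature.MathematicalPhysics.QuantumLattice.RayleighBottom
import HarnessLib

/-!
# Sector-block enclosure certificates for Hubbard ground-state energies: Gram–Gershgorin lower
# bounds on the `(N↑, N↓)` blocks (soundness of exact-diagonalisation LOWER-bound certificates)

Topic `MathematicalPhysics/QuantumLattice` (family `hubbard`); companion of
`BootstrapCertificateDuality.lean` (PSD certificate on the `N`-particle block ⇒ `c ≤ E₀(N)`). An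
exact-diagonalisation certificate works on the smaller `(N↑, N↓) = (a, b)` SECTOR blocks
`H.toBlock (sector a b) (sector a b)` of the Hubbard Hamiltonian `H = hamiltonian G t U` and certifies,
in exact rational arithmetic, an identity `B_{ab} - σ·1 = s⁻¹ (Rᴴ R - E)` with a small Hermitian
remainder `E`; then `λ_min(B_{ab}) ≥ σ - ‖E‖_∞ / s` by the Gershgorin / Schur row-sum bound. This file
proves the implication certificate ⇒ bound on the tree's `groundEnergyAt G t U N`:

* `norm_star_dotProduct_mulVec_le_of_rowSum_colSum` — **Schur's bound**: if every absolute row sum and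
  every absolute column sum of `E` is `≤ r`, then `|⟨v, E v⟩| ≤ r ‖v‖²`; for Hermitian `E` the row sums
  suffice (`re_star_dotProduct_mulVec_ge_neg_of_rowSum`), and
  `posSemidef_gram_sub_add_of_rowSum`: `Rᴴ R - E + r·1 ⪰ 0`.
* `Hubbard.sectorPred a b` — the configuration predicate `#↑ = a ∧ #↓ = b` of the sector block;
  `groundEnergyAt_ge_of_forall_sectorBlock_posSemidef` — **all sectors**: if
  `H.toBlock (sector a b) (sector a b) - c·1 ⪰ 0` for every `a, b ≤ |Λ|` with `a + b = N` (`N ≤ 2|Λ|`),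
  then `c ≤ groundEnergyAt G t U N` (the tree's `LangerMattis.groundEnergyAt_ge_of_forall_isInSector`:
  `H` conserves `(N↑, N↓)`);
* `groundEnergyAt_ge_of_sector_gram_certificates` — the same with, per sector, Gram–Gershgorin data
  `(σ, s > 0, R, E Hermitian, row sums ≤ r)`, `B_{ab} - σ·1 = s⁻¹ • (Rᴴ R - E)` and `c ≤ σ - r/s`;
* `groundEnergyAt_two_mul_ge_of_centralBlock_posSemidef` /
  `groundEnergyAt_two_mul_ge_of_central_gram_certificate` — **one sector suffices for even `N = 2n`**:
  a certificate on the central block `(n, n)` alone bounds `groundEnergyAt G t U (2n)`, by the tree's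
  `SU(2)` reduction `groundEnergyAt_eq_minEnergyOn_szSector` (every spin multiplet meets `S^z = 0`;
  Lieb 1989);
* `groundEnergyAt_le_of_sector_trial` — the upper half: a unit trial vector of any sector `(a, b)`,
  `a + b = N`, gives `groundEnergyAt G t U N ≤ Re⟨ψ, H ψ⟩`.

Standard material: the variational principle and block structure of a symmetric Hamiltonian
(H. Tasaki, *Physics and Mathematics of Quantum Many-Body Systems* (2020) §2.1; E. H. Lieb, PRL 62 (1989)
1201, proof of Thm 1 for the sector decomposition); Schur's test / Gershgorin's theorem for the row-sum
bound (R. A. Horn, C. R. Johnson, *Matrix Analysis* (2013), Thm 6.1.1 and §5.6, `‖E‖₂ ≤ √(‖E‖₁‖E‖_∞)`).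
No named facts; the one definition is the sector predicate.
-/

noncomputable section

open Matrix Finset
open scoped ComplexOrder BigOperators

namespace Literature.MathematicalPhysics.QuantumLattice

open HubbardWave0 RayleighBound

/-! ### Schur's row-sum bound and the Gram–Gershgorin certificate -/

section GramGershgorin

variable {m k : Type*} [Fintype m] [Fintype k]

/-- **Schur's bound**: if every absolute row sum and every absolute column sum of `E` is at most `r`,
then `|⟨v, E v⟩| ≤ r Σ_i |v_i|²` (`|v̄_i E_ij v_j| ≤ |E_ij| (|v_i|² + |v_j|²)/2`). Horn–Johnson (2013)
§5.6 / Thm 6.1.1. [folklore] -/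
theorem norm_star_dotProduct_mulVec_le_of_rowSum_colSum (E : Matrix m m ℂ) {r : ℝ}
    (hrow : ∀ i, ∑ j, ‖E i j‖ ≤ r) (hcol : ∀ j, ∑ i, ‖E i j‖ ≤ r) (v : m → ℂ) :
    ‖star v ⬝ᵥ (E *ᵥ v)‖ ≤ r * ∑ i, ‖v i‖ ^ 2 := by
  have h1 : ‖star v ⬝ᵥ (E *ᵥ v)‖ ≤ ∑ i, ∑ j, ‖E i j‖ * (‖v i‖ * ‖v j‖) := by
    simp only [dotProduct, mulVec, Pi.star_apply, Finset.mul_sum]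
    refine (norm_sum_le _ _).trans (Finset.sum_le_sum fun i _ => ?_)
    refine (norm_sum_le _ _).trans (Finset.sum_le_sum fun j _ => ?_)
    rw [norm_mul, norm_mul, norm_star]
    nlinarith [norm_nonneg (v i), norm_nonneg (v j), norm_nonneg (E i j)]
  have h2 : ∀ i j, ‖E i j‖ * (‖v i‖ * ‖v j‖) ≤ ‖E i j‖ * (‖v i‖ ^ 2 / 2) + ‖E i j‖ * (‖v j‖ ^ 2 / 2) := by
    intro i j
    rw [← mul_add]
    refine mul_le_mul_of_nonneg_left ?_ (norm_nonneg _)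
    nlinarith [sq_nonneg (‖v i‖ - ‖v j‖)]
  have h3 : ∑ i, ∑ j, ‖E i j‖ * (‖v i‖ * ‖v j‖) ≤
      ∑ i, ∑ j, (‖E i j‖ * (‖v i‖ ^ 2 / 2) + ‖E i j‖ * (‖v j‖ ^ 2 / 2)) :=
    Finset.sum_le_sum fun i _ => Finset.sum_le_sum fun j _ => h2 i j
  have h4 : ∑ i, ∑ j, (‖E i j‖ * (‖v i‖ ^ 2 / 2) + ‖E i j‖ * (‖v j‖ ^ 2 / 2)) =
      ∑ i, (‖v i‖ ^ 2 / 2) * ∑ j, ‖E i j‖ + ∑ j, (‖v j‖ ^ 2 / 2) * ∑ i, ‖E i j‖ := by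
    rw [Finset.sum_congr rfl fun i _ => Finset.sum_add_distrib, Finset.sum_add_distrib]
    congr 1
    · refine Finset.sum_congr rfl fun i _ => ?_
      rw [Finset.mul_sum]
      exact Finset.sum_congr rfl fun j _ => by ring
    · rw [Finset.sum_comm]
      refine Finset.sum_congr rfl fun j _ => ?_
      rw [Finset.mul_sum]
      exact Finset.sum_congr rfl fun i _ => by ring
  have h5 : ∑ i, (‖v i‖ ^ 2 / 2) * ∑ j, ‖E i j‖ ≤ ∑ i, (‖v i‖ ^ 2 / 2) * r :=
    Finset.sum_le_sum fun i _ => mul_le_mul_of_nonneg_left (hrow i) (by positivity)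
  have h6 : ∑ j, (‖v j‖ ^ 2 / 2) * ∑ i, ‖E i j‖ ≤ ∑ j, (‖v j‖ ^ 2 / 2) * r :=
    Finset.sum_le_sum fun j _ => mul_le_mul_of_nonneg_left (hcol j) (by positivity)
  have h7 : ∑ i, (‖v i‖ ^ 2 / 2) * r = (r * ∑ i, ‖v i‖ ^ 2) / 2 := by
    rw [Finset.mul_sum, Finset.sum_div]
    exact Finset.sum_congr rfl fun i _ => by ring
  linarith [h1, h3, h4, h5, h6, h7]

/-- For a Hermitian matrix the absolute column sums are the absolute row sums. [folklore] -/
theorem colSum_le_of_rowSum_of_isHermitian {E : Matrix m m ℂ} (hE : E.IsHermitian) {r : ℝ}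
    (hrow : ∀ i, ∑ j, ‖E i j‖ ≤ r) (j : m) : ∑ i, ‖E i j‖ ≤ r := by
  have h : ∀ i, ‖E i j‖ = ‖E j i‖ := fun i => by
    rw [← hE.apply i j, norm_star]
  simp only [h]
  exact hrow j

/-- **Gershgorin / Schur two-sided bound for a Hermitian remainder**: absolute row sums `≤ r` give
`|Re⟨v, E v⟩| ≤ r Σ_i |v_i|²`. Horn–Johnson (2013) Thm 6.1.1. [folklore] -/
theorem abs_re_star_dotProduct_mulVec_le_of_rowSum {E : Matrix m m ℂ} (hE : E.IsHermitian) {r : ℝ}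
    (hrow : ∀ i, ∑ j, ‖E i j‖ ≤ r) (v : m → ℂ) :
    |(star v ⬝ᵥ (E *ᵥ v)).re| ≤ r * ∑ i, ‖v i‖ ^ 2 :=
  (Complex.abs_re_le_norm _).trans (norm_star_dotProduct_mulVec_le_of_rowSum_colSum E hrow
    (colSum_le_of_rowSum_of_isHermitian hE hrow) v)

/-- Lower form: `Re⟨v, E v⟩ ≥ -r Σ_i |v_i|²`. [folklore] -/
theorem re_star_dotProduct_mulVec_ge_neg_of_rowSum {E : Matrix m m ℂ} (hE : E.IsHermitian) {r : ℝ}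
    (hrow : ∀ i, ∑ j, ‖E i j‖ ≤ r) (v : m → ℂ) :
    -(r * ∑ i, ‖v i‖ ^ 2) ≤ (star v ⬝ᵥ (E *ᵥ v)).re :=
  (abs_le.1 (abs_re_star_dotProduct_mulVec_le_of_rowSum hE hrow v)).1

/-- Upper form: `Re⟨v, E v⟩ ≤ r Σ_i |v_i|²`. [folklore] -/
theorem re_star_dotProduct_mulVec_le_of_rowSum {E : Matrix m m ℂ} (hE : E.IsHermitian) {r : ℝ}
    (hrow : ∀ i, ∑ j, ‖E i j‖ ≤ r) (v : m → ℂ) :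
    (star v ⬝ᵥ (E *ᵥ v)).re ≤ r * ∑ i, ‖v i‖ ^ 2 :=
  (abs_le.1 (abs_re_star_dotProduct_mulVec_le_of_rowSum hE hrow v)).2

/-- **The Gram–Gershgorin certificate is positive semidefinite**: for any `R` and any Hermitian `E` with
absolute row sums `≤ r`, `Rᴴ R - E + r·1 ⪰ 0`. This is the exact form of "`λ_min(Rᴴ R - E) ≥ -‖E‖_∞`"
used by rounded Cholesky / `LDLᵀ` certificates. Horn–Johnson (2013) Thm 6.1.1, §7.2. [folklore] -/
theorem posSemidef_gram_sub_add_of_rowSum [DecidableEq m] (R : Matrix k m ℂ) {E : Matrix m m ℂ}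
    (hE : E.IsHermitian) {r : ℝ} (hrow : ∀ i, ∑ j, ‖E i j‖ ≤ r) :
    (Rᴴ * R - E + (r : ℂ) • (1 : Matrix m m ℂ)).PosSemidef := by
  have hherm : (Rᴴ * R - E + (r : ℂ) • (1 : Matrix m m ℂ)).IsHermitian := by
    refine ((isHermitian_conjTranspose_mul_self R).sub hE).add ?_
    rw [IsHermitian, conjTranspose_smul, conjTranspose_one, Complex.star_def, Complex.conj_ofReal]
  refine Matrix.PosSemidef.of_dotProduct_mulVec_nonneg hherm fun v => ?_
  have him := hherm.im_star_dotProduct_mulVec_self v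
  simp only [RCLike.im_to_complex] at him
  refine Complex.nonneg_iff.2 ⟨?_, him.symm⟩
  have hgram : (star v ⬝ᵥ ((Rᴴ * R) *ᵥ v)).re = ∑ i, ‖(R *ᵥ v) i‖ ^ 2 := by
    rw [← mulVec_mulVec, dotProduct_mulVec, ← star_mulVec, RayleighBottom.star_dotProduct_self_eq_sum,
      Complex.ofReal_re]
  have hE' := re_star_dotProduct_mulVec_le_of_rowSum hE hrow v
  have hone : (star v ⬝ᵥ (((r : ℂ) • (1 : Matrix m m ℂ)) *ᵥ v)).re = r * ∑ i, ‖v i‖ ^ 2 := by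
    rw [smul_mulVec, one_mulVec, dotProduct_smul, RayleighBottom.star_dotProduct_self_eq_sum, smul_eq_mul,
      ← Complex.ofReal_mul, Complex.ofReal_re]
  have hsq : (0 : ℝ) ≤ ∑ i, ‖(R *ᵥ v) i‖ ^ 2 := Finset.sum_nonneg fun i _ => by positivity
  rw [add_mulVec, sub_mulVec, dotProduct_add, dotProduct_sub, Complex.add_re, Complex.sub_re, hgram, hone]
  linarith

/-- **From the certificate identity to the block bound**: if `B - σ·1 = s⁻¹ • (Rᴴ R - E)` with `s > 0`,
`E` Hermitian with absolute row sums `≤ r`, then `B - (σ - r/s)·1 ⪰ 0`. [folklore] -/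
theorem posSemidef_sub_of_gram_certificate [DecidableEq m] {B : Matrix m m ℂ} (R : Matrix k m ℂ)
    {E : Matrix m m ℂ} (hE : E.IsHermitian) {σ s r : ℝ} (hs : 0 < s) (hrow : ∀ i, ∑ j, ‖E i j‖ ≤ r)
    (hid : B - (σ : ℂ) • (1 : Matrix m m ℂ) = ((s⁻¹ : ℝ) : ℂ) • (Rᴴ * R - E)) :
    (B - ((σ - r / s : ℝ) : ℂ) • (1 : Matrix m m ℂ)).PosSemidef := by
  have hkey : B - ((σ - r / s : ℝ) : ℂ) • (1 : Matrix m m ℂ) =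
      ((s⁻¹ : ℝ) : ℂ) • (Rᴴ * R - E + (r : ℂ) • (1 : Matrix m m ℂ)) := by
    have h1 : B - ((σ - r / s : ℝ) : ℂ) • (1 : Matrix m m ℂ) =
        (B - (σ : ℂ) • (1 : Matrix m m ℂ)) + ((r / s : ℝ) : ℂ) • (1 : Matrix m m ℂ) := by
      rw [Complex.ofReal_sub, sub_smul]
      abel
    rw [h1, hid, smul_add, smul_smul, ← Complex.ofReal_mul,
      show s⁻¹ * r = r / s by rw [div_eq_mul_inv, mul_comm]]
  rw [hkey]
  exact (posSemidef_gram_sub_add_of_rowSum R hE hrow).smul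
    (Complex.zero_le_real.2 (inv_nonneg.2 hs.le))

end GramGershgorin

/-! ### Sector blocks of the Hubbard Hamiltonian -/

section Sectors

variable {Λ : Type*} [LinearOrder Λ] [Fintype Λ] (G : SimpleGraph Λ) [DecidableRel G.Adj]

/-- The configuration predicate of the `(N↑, N↓) = (a, b)` sector: `#↑(s) = a ∧ #↓(s) = b`
(so `H.toBlock (sectorPred a b) (sectorPred a b)` is the sector block an exact diagonalisation handles,
and `IsInSector a b ψ ↔ ψ` vanishes off `sectorPred a b`). Lieb (1989), proof of Thm 1. [folklore] -/
def Hubbard.sectorPred (a b : ℕ) (s : Finset (Orb Λ)) : Prop :=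
  (upPart s).card = a ∧ (downPart s).card = b

/-- The sector predicate is decidable (so `Matrix.toBlock` along it is a concrete finite block).
[folklore] -/
instance Hubbard.instDecidablePredSectorPred (a b : ℕ) :
    DecidablePred (Hubbard.sectorPred (Λ := Λ) a b) :=
  fun s => inferInstanceAs (Decidable ((upPart s).card = a ∧ (downPart s).card = b))

/-- `IsInSector a b ψ` says that `ψ` is supported in `sectorPred a b` (definitional). [folklore] -/
theorem Hubbard.isInSector_iff_support (a b : ℕ) (ψ : Fock (Orb Λ)) :
    IsInSector a b ψ ↔ ∀ s, ¬ Hubbard.sectorPred a b s → ψ s = 0 := Iff.rfl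

/-- **A PSD sector block bounds the sector Rayleigh quotients**: if
`H.toBlock (sectorPred a b) (sectorPred a b) - c·1 ⪰ 0`, then `c ‖φ‖² ≤ Re⟨φ, H φ⟩` for every `φ` of the
sector `(a, b)`. Tasaki (2020) §2.1. [folklore] -/
theorem Hubbard.mul_normSq_le_of_sectorBlock_posSemidef (H : Matrix (Finset (Orb Λ)) (Finset (Orb Λ)) ℂ)
    {a b : ℕ} {c : ℝ}
    (h : (H.toBlock (Hubbard.sectorPred a b) (Hubbard.sectorPred a b) -
      (c : ℂ) • (1 : Matrix _ _ ℂ)).PosSemidef)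
    (φ : Fock (Orb Λ)) (hφ : IsInSector a b φ) :
    c * normSq φ ≤ (star φ ⬝ᵥ (H *ᵥ φ)).re := by
  have hsupp : ∀ s, ¬ Hubbard.sectorPred a b s → φ s = 0 := hφ
  set φ' : {s : Finset (Orb Λ) // Hubbard.sectorPred a b s} → ℂ := fun s => φ s.1 with hφ'
  have h0 := h.dotProduct_mulVec_nonneg φ'
  rw [sub_mulVec, dotProduct_sub, smul_mulVec, one_mulVec, dotProduct_smul, hφ',
    star_restrict_dotProduct_toBlock_mulVec (Hubbard.sectorPred a b) H φ hsupp,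
    star_restrict_dotProduct_restrict (Hubbard.sectorPred a b) φ φ hsupp,
    star_dotProduct_self_eq_normSq] at h0
  obtain ⟨hre, -⟩ := Complex.nonneg_iff.mp h0
  simp only [Complex.sub_re, smul_eq_mul, ← Complex.ofReal_mul, Complex.ofReal_re] at hre
  linarith

/-- **All-sector block certificates bound the ground-state energy.** If for every sector `(a, b)` with
`a, b ≤ |Λ|` and `a + b = N` the block `H.toBlock (sectorPred a b) (sectorPred a b) - c·1` is positive
semidefinite (`H = hamiltonian G t U`, `N ≤ 2|Λ|`), then `c ≤ groundEnergyAt G t U N`. The ground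
state of the `N`-particle sector has a nonzero component in some `(a, b)` block (`H` conserves
`N↑, N↓`). Lieb (1989), proof of Thm 1; Tasaki (2020) §2.1. [folklore] -/
theorem groundEnergyAt_ge_of_forall_sectorBlock_posSemidef (t U : ℝ) {N : ℕ}
    (hN : N ≤ 2 * Fintype.card Λ) {c : ℝ}
    (h : ∀ a b : ℕ, a ≤ Fintype.card Λ → b ≤ Fintype.card Λ → a + b = N →
      ((hamiltonian G t U).toBlock (Hubbard.sectorPred a b) (Hubbard.sectorPred a b) -
        (c : ℂ) • (1 : Matrix _ _ ℂ)).PosSemidef) :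
    c ≤ groundEnergyAt G t U N := by
  refine LangerMattis.groundEnergyAt_ge_of_forall_isInSector G t U hN fun a b hab φ hφ => ?_
  by_cases hφ0 : φ = 0
  · subst hφ0
    simp [normSq]
  obtain ⟨ha, hb⟩ := le_card_of_isInSector hφ hφ0
  exact Hubbard.mul_normSq_le_of_sectorBlock_posSemidef (hamiltonian G t U) (h a b ha hb hab) φ hφ

/-- **All-sector Gram–Gershgorin certificates bound the ground-state energy**: if every sector block
`B_{ab} = H.toBlock (sectorPred a b) (sectorPred a b)` (`a, b ≤ |Λ|`, `a + b = N ≤ 2|Λ|`) carries data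
`σ, s > 0, r`, a matrix `R` and a Hermitian `E` with absolute row sums `≤ r` such that
`B_{ab} - σ·1 = s⁻¹ • (Rᴴ R - E)` and `c ≤ σ - r/s`, then `c ≤ groundEnergyAt G t U N`. (How `R`, `σ`
were found — floating-point Cholesky of `B - σ` and rounding — is irrelevant; the identity and the row
sums are exact rational checks.) [folklore] -/
theorem groundEnergyAt_ge_of_sector_gram_certificates (t U : ℝ) {N : ℕ}
    (hN : N ≤ 2 * Fintype.card Λ) {c : ℝ}
    (h : ∀ a b : ℕ, a ≤ Fintype.card Λ → b ≤ Fintype.card Λ → a + b = N →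
      ∃ (σ s r : ℝ) (R E : Matrix {x : Finset (Orb Λ) // Hubbard.sectorPred a b x}
          {x : Finset (Orb Λ) // Hubbard.sectorPred a b x} ℂ),
        0 < s ∧ E.IsHermitian ∧ (∀ i, ∑ j, ‖E i j‖ ≤ r) ∧
        (hamiltonian G t U).toBlock (Hubbard.sectorPred a b) (Hubbard.sectorPred a b) -
            (σ : ℂ) • (1 : Matrix _ _ ℂ) = ((s⁻¹ : ℝ) : ℂ) • (Rᴴ * R - E) ∧
        c ≤ σ - r / s) :
    c ≤ groundEnergyAt G t U N := by
  refine LangerMattis.groundEnergyAt_ge_of_forall_isInSector G t U hN fun a b hab φ hφ => ?_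
  by_cases hφ0 : φ = 0
  · subst hφ0
    simp [normSq]
  obtain ⟨ha, hb⟩ := le_card_of_isInSector hφ hφ0
  obtain ⟨σ, s, r, R, E, hs, hE, hrow, hid, hc⟩ := h a b ha hb hab
  have hblock := posSemidef_sub_of_gram_certificate R hE hs hrow hid
  have hle := Hubbard.mul_normSq_le_of_sectorBlock_posSemidef (hamiltonian G t U) hblock φ hφ
  have hn : 0 ≤ normSq φ := by unfold normSq; positivity
  nlinarith

/-! ### Even particle number: the central sector alone -/

/-- **One sector suffices for `N = 2n`**: a PSD certificate on the central block
`H.toBlock (sectorPred n n) (sectorPred n n) - c·1 ⪰ 0` (`n ≤ |Λ|`) gives `c ≤ groundEnergyAt G t U (2n)`,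
because every spin multiplet of the `2n`-particle space meets the `S^z = 0` sector
(`groundEnergyAt_eq_minEnergyOn_szSector`). Lieb (1989), proof of Thm 1; Lieb–Wu (2003) §5. [folklore] -/
theorem groundEnergyAt_two_mul_ge_of_centralBlock_posSemidef (t U : ℝ) {n : ℕ}
    (hn : n ≤ Fintype.card Λ) {c : ℝ}
    (h : ((hamiltonian G t U).toBlock (Hubbard.sectorPred n n) (Hubbard.sectorPred n n) -
      (c : ℂ) • (1 : Matrix _ _ ℂ)).PosSemidef) :
    c ≤ groundEnergyAt G t U (2 * n) := by
  rw [groundEnergyAt_eq_minEnergyOn_szSector G t U hn]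
  obtain ⟨⟨ψ₁, hψ₁⟩, -⟩ := szSector_groundState G t U hn
  unfold Matrix.minEnergyOn
  refine le_csInf ?_ ?_
  · obtain ⟨hmem, hψ0, -⟩ := hψ₁
    obtain ⟨d, -, -, hd1⟩ := EigenvalueContinuation.exists_normalize hψ0
    exact ⟨_, (d : ℂ) • ψ₁, Submodule.smul_mem _ _ hmem, hd1, rfl⟩
  · rintro E ⟨ψ, hψ, hψ1, rfl⟩
    have hsec : IsInSector n n ψ := by
      have h2 : szSector (Λ := Λ) (2 * n) 0 = szSector (n + n) (((n : ℝ) - n) / 2) := by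
        rw [two_mul, sub_self, zero_div]
      rw [h2] at hψ
      exact (mem_szSector_iff_isInSector n n ψ).1 hψ
    have hle := Hubbard.mul_normSq_le_of_sectorBlock_posSemidef (hamiltonian G t U) h ψ hsec
    have hnorm : normSq ψ = 1 := by
      have h3 := star_dotProduct_self_eq_normSq ψ
      rw [hψ1] at h3
      exact_mod_cast h3.symm
    rw [hnorm, mul_one] at hle
    exact hle

/-- **Central-sector Gram–Gershgorin certificate** (`N = 2n`, `n ≤ |Λ|`):
`B_{nn} - σ·1 = s⁻¹ • (Rᴴ R - E)`, `E` Hermitian with absolute row sums `≤ r`, `s > 0` ⇒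
`σ - r/s ≤ groundEnergyAt G t U (2n)`. [folklore] -/
theorem groundEnergyAt_two_mul_ge_of_central_gram_certificate (t U : ℝ) {n : ℕ}
    (hn : n ≤ Fintype.card Λ) {σ s r : ℝ} {k : Type*} [Fintype k]
    (R : Matrix k {x : Finset (Orb Λ) // Hubbard.sectorPred n n x} ℂ)
    {E : Matrix {x : Finset (Orb Λ) // Hubbard.sectorPred n n x}
      {x : Finset (Orb Λ) // Hubbard.sectorPred n n x} ℂ}
    (hE : E.IsHermitian) (hs : 0 < s) (hrow : ∀ i, ∑ j, ‖E i j‖ ≤ r)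
    (hid : (hamiltonian G t U).toBlock (Hubbard.sectorPred n n) (Hubbard.sectorPred n n) -
      (σ : ℂ) • (1 : Matrix _ _ ℂ) = ((s⁻¹ : ℝ) : ℂ) • (Rᴴ * R - E)) :
    σ - r / s ≤ groundEnergyAt G t U (2 * n) :=
  groundEnergyAt_two_mul_ge_of_centralBlock_posSemidef G t U hn
    (posSemidef_sub_of_gram_certificate R hE hs hrow hid)

/-! ### The upper half: a trial vector in one sector -/

/-- **Sector trial vectors bound the ground-state energy from above**: a unit vector `ψ` of the sector
`(a, b)` with `a + b = N` gives `groundEnergyAt G t U N ≤ Re⟨ψ, H ψ⟩` (no symmetry needed; used with an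
exact rational `ψ`, e.g. a rounded eigenvector). Tasaki (2020) §2.1. [folklore] -/
theorem groundEnergyAt_le_of_sector_trial (t U : ℝ) {a b N : ℕ} (hab : a + b = N) {ψ : Fock (Orb Λ)}
    (hψ : IsInSector a b ψ) (hψ1 : star ψ ⬝ᵥ ψ = 1) :
    groundEnergyAt G t U N ≤ (star ψ ⬝ᵥ (hamiltonian G t U *ᵥ ψ)).re := by
  have hN : IsNParticle N ψ := hab ▸ hψ.isNParticle
  exact ThermodynamicLimit.groundEnergy_le_re_expect (hamiltonian G t U) hN hψ1

end Sectors

end Literature.MathematicalPhysics.QuantumLattice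

end
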